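import Summits.CriticalPhenomena.PercolationContinuityZ3.Theorems.Transplant.SkelPhiCorridorKGKits
import HarnessLib

/-!
# N2 (frames-only node `SamePDropOfSkeletonFrm₁`, OPEN), (C) column: **THE PER-STEP PER-CENTRE INPUT OF THE K-G CORRIDOR OF RECORD, BY PHASE** —
# `Skelφ.hrouteS_kgCorr`: the hypothesis `hrouteS` of `hkits_schedFHab` (SkelPhiCorridorStepsFHab) for `S := kgCorrSched hP₁ hP₂ hsplit`
# (SkelPhiParaCorridorKG p341223) read in the frame `runX φ c₀ n h σ` over a habitat `Ω`, from the LONG LINKS at every centre (side halves for the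
# run and the along-parking, top pieces for the across-parking) at accuracy `δ³`: step `k` is dispatched to `hroute_runBIn` (`k ≤ N`),
# `hroute_yParkCIn` (`k = N+1+j`, `j ≤ m₁`) or `hroute_xParkCIn` (`k = N+1+m₁+1+j`) through the phase views `corrSchedNP_run/park₁/park₂` and the
# two joins `kgJoin₁/kgJoin₂` at the phase boundaries (the next core of the last step of a phase is the first core of the next phase).

builds on p205010 (kernel theorem, internal audit signed; external expert review pending) — nothing in this file uses p205010; nothing here is a
claim about the open node `SamePDropOfSkeletonFrm₁`.
Lane `prim-bschramm`, seat `prim-bschramm-p5` (gen 15; (C) lineage; (R-22) K-G); helper file (`--supports stmt-CriticalPhenomena-4575 --as helper`).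
* §1 phase views of `kgCorrSched`: `kgCorrSched_run_view`, `kgCorrSched_core_succ_run`, `kgCorrSched_park₁_view`, `kgCorrSched_core_succ_park₁`,
  `kgCorrSched_park₂_view`, `kgCorrSched_core_succ_park₂`, `kgCorrSched_step_cases`;
* §2 **`hrouteS_kgCorr`**.
[cite: KozmaNitzan2024, §4 Lemma 10 Step IV (pp. 20–21), Lemma 11 (pp. 22–23), Lemma 12 (pp. 23–25)] [cite: MartineauTassion2017, §4.3 Lemma 4.2]
-/

noncomputable section

open scoped Classical

namespace Summit.CriticalPhenomena.PercolationContinuityZ3.Theorems.Transplant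

namespace Skelφ

open MeasureTheory
open Literature.Probability.Percolation Literature.Probability.LatticeModels SimpleGraph KNLevels
open Literature.Barriers.CriticalPhenomena (graphBall graphBall_mono)
open Skel (winGraph winGraph_le winGraphIn winGraphIn_le)
open Literature.Probability.Percolation.KozmaNitzan.Cells (oth)
open ChainPlanar ChainPara

variable {V : Type} [DecidableEq V] [Countable V] {G : SimpleGraph V} [G.LocallyFinite] {φ : V → Site 2}

section KG

variable {n ℓ : ℕ} {h v : ℤ} {R' ρ q W N m₁ Wm₂ Wp₂ m₂ : ℕ}
  (hP₁ : ParkOK (kgPark₁ n ℓ h v R' ρ q W N m₁)) (hP₂ : ParkOK (kgPark₂ n ℓ h v R' ρ q W N m₁ Wm₂ Wp₂ m₂))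
  (hsplit : (Wm₂ : ℤ) + Wp₂ = (kgPark₁ n ℓ h v R' ρ q W N m₁).aHi (m₁ + 1) - ParkPrm.aLo (kgPark₁ n ℓ h v R' ρ q W N m₁) (m₁ + 1))

/-! ## §1 The phase views of the corridor of record -/

/-- **Run phase view** (`k ≤ N`): region, levels and core of `kgCorrSched` are those of `xRunSchedB`. [folklore] -/
theorem kgCorrSched_run_view {k : ℕ} (hk : k ≤ N) :
    (kgCorrSched hP₁ hP₂ hsplit).region k = (xRunSchedB n ℓ h R' q W N).region k ∧
    (∀ i, (kgCorrSched hP₁ hP₂ hsplit).level k i = (xRunSchedB n ℓ h R' q W N).level k i) ∧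
    (kgCorrSched hP₁ hP₂ hsplit).core k = (xRunSchedB n ℓ h R' q W N).core k := by
  obtain ⟨-, hreg, hlev, hcore⟩ := corrSchedNP_run (xRunPrmB n ℓ h R' q W N) (kgPark₁ n ℓ h v R' ρ q W N m₁)
    (kgPark₂ n ℓ h v R' ρ q W N m₁ Wm₂ Wp₂ m₂) 0 (σ := 1) (Or.inl rfl) 0 (kgC₁ n N) (kgC₂ n ℓ h v R' ρ q W N m₁ Wp₂)
    (xRunPrmB_ok n ℓ h R' q W N) (xRunPrmB_eb n ℓ h R' q W N) hP₁ (yParkPrmW_eb n ℓ h v R' ρ _ _ _ _ m₁) hP₂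
    (xParkPrmW_eb n ℓ h R' ρ _ _ _ _ m₂) rfl rfl rfl (kgJoin₁ hP₁) (kgJoin₂ hP₁ hP₂ hsplit) hk
  exact ⟨hreg, fun i => hlev i, hcore⟩

/-- **Across-parking phase view** (`k = N + 1 + j`, `j ≤ m₁`). [folklore] -/
theorem kgCorrSched_park₁_view {j : ℕ} (hj : j ≤ m₁) :
    (kgCorrSched hP₁ hP₂ hsplit).region (N + 1 + j) = (yParkSchedC hP₁ (kgC₁ n N)).region j ∧
    (∀ i, (kgCorrSched hP₁ hP₂ hsplit).level (N + 1 + j) i = (yParkSchedC hP₁ (kgC₁ n N)).level j i) ∧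
    (kgCorrSched hP₁ hP₂ hsplit).core (N + 1 + j) = (yParkSchedC hP₁ (kgC₁ n N)).core j := by
  obtain ⟨-, hreg, hlev, hcore⟩ := corrSchedNP_park₁ (xRunPrmB n ℓ h R' q W N) (kgPark₁ n ℓ h v R' ρ q W N m₁)
    (kgPark₂ n ℓ h v R' ρ q W N m₁ Wm₂ Wp₂ m₂) 0 (σ := 1) (Or.inl rfl) 0 (kgC₁ n N) (kgC₂ n ℓ h v R' ρ q W N m₁ Wp₂)
    (xRunPrmB_ok n ℓ h R' q W N) (xRunPrmB_eb n ℓ h R' q W N) hP₁ (yParkPrmW_eb n ℓ h v R' ρ _ _ _ _ m₁) hP₂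
    (xParkPrmW_eb n ℓ h R' ρ _ _ _ _ m₂) rfl rfl rfl (kgJoin₁ hP₁) (kgJoin₂ hP₁ hP₂ hsplit) hj
  exact ⟨hreg, fun i => hlev i, hcore⟩

/-- **Along-parking phase view** (`k = N + 1 + m₁ + 1 + j`). [folklore] -/
theorem kgCorrSched_park₂_view (j : ℕ) :
    (kgCorrSched hP₁ hP₂ hsplit).region (N + 1 + m₁ + 1 + j) = (xParkSchedC hP₂ (kgC₂ n ℓ h v R' ρ q W N m₁ Wp₂)).region j ∧
    (∀ i, (kgCorrSched hP₁ hP₂ hsplit).level (N + 1 + m₁ + 1 + j) i = (xParkSchedC hP₂ (kgC₂ n ℓ h v R' ρ q W N m₁ Wp₂)).level j i) ∧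
    (kgCorrSched hP₁ hP₂ hsplit).core (N + 1 + m₁ + 1 + j) = (xParkSchedC hP₂ (kgC₂ n ℓ h v R' ρ q W N m₁ Wp₂)).core j := by
  obtain ⟨-, hreg, hlev, hcore⟩ := corrSchedNP_park₂ (xRunPrmB n ℓ h R' q W N) (kgPark₁ n ℓ h v R' ρ q W N m₁)
    (kgPark₂ n ℓ h v R' ρ q W N m₁ Wm₂ Wp₂ m₂) 0 (σ := 1) (Or.inl rfl) 0 (kgC₁ n N) (kgC₂ n ℓ h v R' ρ q W N m₁ Wp₂)
    (xRunPrmB_ok n ℓ h R' q W N) (xRunPrmB_eb n ℓ h R' q W N) hP₁ (yParkPrmW_eb n ℓ h v R' ρ _ _ _ _ m₁) hP₂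
    (xParkPrmW_eb n ℓ h R' ρ _ _ _ _ m₂) rfl rfl rfl (kgJoin₁ hP₁) (kgJoin₂ hP₁ hP₂ hsplit) j
  exact ⟨hreg, fun i => hlev i, hcore⟩

/-- **The next core of a run step is the run's next core** (at `k = N` through the first join). [folklore] -/
theorem kgCorrSched_core_succ_run {k : ℕ} (hk : k ≤ N) :
    (kgCorrSched hP₁ hP₂ hsplit).core (k + 1) = (xRunSchedB n ℓ h R' q W N).core (k + 1) := by
  rcases Nat.lt_or_eq_of_le hk with hlt | rfl
  · exact (kgCorrSched_run_view hP₁ hP₂ hsplit (k := k + 1) (by omega)).2.2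
  · rw [show k + 1 = k + 1 + 0 by rfl, (kgCorrSched_park₁_view hP₁ hP₂ hsplit (j := 0) (Nat.zero_le _)).2.2]
    exact kgJoin₁ hP₁

/-- **The next core of an across-parking step** (at `j = m₁` through the second join). [folklore] -/
theorem kgCorrSched_core_succ_park₁ {j : ℕ} (hj : j ≤ m₁) :
    (kgCorrSched hP₁ hP₂ hsplit).core (N + 1 + j + 1) = (yParkSchedC hP₁ (kgC₁ n N)).core (j + 1) := by
  rcases Nat.lt_or_eq_of_le hj with hlt | rfl
  · rw [show N + 1 + j + 1 = N + 1 + (j + 1) by omega]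
    exact (kgCorrSched_park₁_view hP₁ hP₂ hsplit (j := j + 1) (by omega)).2.2
  · rw [show N + 1 + j + 1 = N + 1 + j + 1 + 0 by rfl, (kgCorrSched_park₂_view hP₁ hP₂ hsplit 0).2.2]
    exact kgJoin₂ hP₁ hP₂ hsplit

/-- **The next core of an along-parking step.** [folklore] -/
theorem kgCorrSched_core_succ_park₂ (j : ℕ) :
    (kgCorrSched hP₁ hP₂ hsplit).core (N + 1 + m₁ + 1 + j + 1) = (xParkSchedC hP₂ (kgC₂ n ℓ h v R' ρ q W N m₁ Wp₂)).core (j + 1) := by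
  rw [show N + 1 + m₁ + 1 + j + 1 = N + 1 + m₁ + 1 + (j + 1) by omega]
  exact (kgCorrSched_park₂_view hP₁ hP₂ hsplit (j + 1)).2.2

omit hP₁ hP₂ hsplit in
/-- The three phases exhaust the steps `k ≤ N + 1 + m₁ + 1 + m₂`. [folklore] -/
theorem kgCorrSched_step_cases {k : ℕ} (hk : k ≤ N + 1 + m₁ + 1 + m₂) :
    k ≤ N ∨ (∃ j, j ≤ m₁ ∧ k = N + 1 + j) ∨ (∃ j, j ≤ m₂ ∧ k = N + 1 + m₁ + 1 + j) := by
  by_cases h1 : k ≤ N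
  · exact Or.inl h1
  by_cases h2 : k ≤ N + 1 + m₁
  · exact Or.inr (Or.inl ⟨k - (N + 1), by omega, by omega⟩)
  · exact Or.inr (Or.inr ⟨k - (N + 1 + m₁ + 1), by omega, by omega⟩)

/-! ## §2 The per-step per-centre input of the corridor of record -/

/-- **THE PER-STEP PER-CENTRE PARKED-OR-ROUTED INPUT OF THE K-G CORRIDOR OF RECORD** (`hrouteS` of `hkits_schedFHab` at `S := kgCorrSched …`): from
the long x-links (side halves, both transverse signs) and the long y′-links (top pieces, both signs) at every centre at accuracy `δ³`, the window-in-
habitat row and a sub-box law on every region window. [cite: KozmaNitzan2024, §4 Lemma 10 Step IV, Lemma 12] [cite: MartineauTassion2017, §4.3 Lemma 4.2] -/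
theorem hrouteS_kgCorr (hn : 1 ≤ n) (c₀ : V) {σ : ℤ} (hσ : σ = 1 ∨ σ = -1) {w₀ : V} {R r Rl : ℕ} (hr : Rl ≤ r) (hrR : r ≤ R)
    {Ω : Finset V} (hΩball : ∀ u ∈ graphBall G w₀ R, runX φ c₀ n h σ u ∈ (kgCorrSched hP₁ hP₂ hsplit).prism → u ∈ Ω) (Rim : ℕ → Finset V)
    {q' : unitInterval} {W' : Sym2 V → unitInterval}
    (hWD : ∀ k ≤ (kgCorrSched hP₁ hP₂ hsplit).N, IsSubbox (winGraphIn G Ω) W' q' (WinIn (runX φ c₀ n h σ) Ω ((kgCorrSched hP₁ hP₂ hsplit).region k)))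
    (Λc : V → ℕ → Finset V) (kz : ℕ) {δ : ℝ}
    (hlong : ∀ c (τ : ℤ), τ = 1 ∨ τ = -1 → 1 - δ ^ 3 < (bondPercolation G q').real
      (linkIn (pgramPrism G φ c n h (3 * ℓ) Rl) (Λc c kz) (pgSideHalfW G φ c n h ℓ Rl σ (σ * τ))))
    (hlongY : ∀ c (τ : ℤ), τ = 1 ∨ τ = -1 → 1 - δ ^ 3 < (bondPercolation G q').real
      (linkIn (pgramPrism G φ c n h (3 * ℓ) Rl) (Λc c kz) (pgTopPieceW G φ c n h ℓ Rl σ τ v))) :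
    ∀ k ≤ (kgCorrSched hP₁ hP₂ hsplit).N, ∀ c : V,
      runX φ c₀ n h σ c ∈ Finset.Icc ((kgCorrSched hP₁ hP₂ hsplit).lo k - (((kgCorrSched hP₁ hP₂ hsplit).R' : ℕ) : Site 2))
        ((kgCorrSched hP₁ hP₂ hsplit).hi k + (((kgCorrSched hP₁ hP₂ hsplit).R' : ℕ) : Site 2)) → c ∈ graphBall G w₀ (R - r) →
      c ∈ WinIn (runX φ c₀ n h σ) Ω (ScheduleNP.core (kgCorrSched hP₁ hP₂ hsplit) (k + 1)) ∪ Rim k ∨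
      ∃ Qt Ft : Finset V, Ft ⊆ WinIn (runX φ c₀ n h σ) Ω (ScheduleNP.core (kgCorrSched hP₁ hP₂ hsplit) (k + 1)) ∪ Rim k ∧
        Qt ⊆ WinIn (runX φ c₀ n h σ) Ω ((kgCorrSched hP₁ hP₂ hsplit).region k) ∧
        1 - δ ^ 3 ≤ (prodBernoulli W').real (linkIn (↑Qt : Set V) (Λc c kz) Ft) := by
  set S := kgCorrSched hP₁ hP₂ hsplit with hS
  set ψ := runX φ c₀ n h σ with hψ
  have hSN : S.N = N + 1 + m₁ + 1 + m₂ := rfl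
  have hSR : S.R' = R' := rfl
  intro k hk c hc hcw
  -- generic transport: a plain window over a phase region / next core lies in the habitat window of the corridor's
  have hPDof : ∀ {Reg : Finset (Site 2)}, Reg = S.region k → Win G ψ w₀ Reg R ⊆ WinIn ψ Ω (S.region k) := by
    intro Reg hReg u hu
    obtain ⟨huB, huP⟩ := (mem_Win G _).1 hu
    rw [hReg] at huP
    exact (mem_WinIn (φ := ψ)).2 ⟨hΩball u huB (S.sub_prism k hk huP), huP⟩
  have hPTof : ∀ {Cor : Finset (Site 2)}, Cor = ScheduleNP.core S (k + 1) → Win G ψ w₀ Cor R ⊆ WinIn ψ Ω (ScheduleNP.core S (k + 1)) ∪ Rim k := by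
    intro Cor hCor u hu
    obtain ⟨huB, huP⟩ := (mem_Win G _).1 hu
    rw [hCor] at huP
    exact Finset.mem_union_left _ ((mem_WinIn (φ := ψ)).2 ⟨hΩball u huB (S.sub_prism k hk (S.succ k hk huP)), huP⟩)
  have hDrΩ : WinIn ψ Ω (S.region k) ⊆ Ω := fun u hu => ((mem_WinIn (φ := ψ)).1 hu).1
  have hc' : ψ c ∈ ScheduleNP.level S k S.R' := hc
  rcases kgCorrSched_step_cases (N := N) (m₁ := m₁) (m₂ := m₂) (k := k) (hk.trans_eq hSN) with hkN | ⟨j, hj, rfl⟩ | ⟨j, hj, rfl⟩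
  · -- run phase
    obtain ⟨hreg, hlev, -⟩ := kgCorrSched_run_view hP₁ hP₂ hsplit hkN
    have hcs := kgCorrSched_core_succ_run hP₁ hP₂ hsplit hkN
    rw [hlev] at hc'
    exact hroute_runBIn (φ := φ) hn c₀ hσ (k := k) hr hrR (hPDof hreg.symm) (hPTof hcs.symm) hDrΩ (hWD k hk) Λc kz hlong c hc' hcw
  · -- across-parking phase
    obtain ⟨hreg, hlev, -⟩ := kgCorrSched_park₁_view hP₁ hP₂ hsplit hj
    have hcs := kgCorrSched_core_succ_park₁ hP₁ hP₂ hsplit hj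
    rw [hlev] at hc'
    exact hroute_yParkCIn (φ := φ) hP₁ (kgC₁ n N) hn c₀ hσ (k := j) hr hrR (hPDof hreg.symm) (hPTof hcs.symm) hDrΩ (hWD _ hk) Λc kz hlongY
      c hc' hcw
  · -- along-parking phase
    obtain ⟨hreg, hlev, -⟩ := kgCorrSched_park₂_view hP₁ hP₂ hsplit j
    have hcs := kgCorrSched_core_succ_park₂ hP₁ hP₂ hsplit j
    rw [hlev] at hc'
    exact hroute_xParkCIn (φ := φ) hP₂ (kgC₂ n ℓ h v R' ρ q W N m₁ Wp₂) hn c₀ hσ (k := j) hr hrR (hPDof hreg.symm) (hPTof hcs.symm) hDrΩ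
      (hWD _ hk) Λc kz hlong c hc' hcw

end KG

end Skelφ

end Summit.CriticalPhenomena.PercolationContinuityZ3.Theorems.Transplant

end
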